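import Mathlib
import HarnessLib
import Literature.MathematicalPhysics.StatisticalMechanics.KosterlitzRecursionFlowDichotomy
import Literature.MathematicalPhysics.StatisticalMechanics.KosterlitzUniversalJumpRobust

/-!
# The fixed line attracts for `K > 2/π`; the critical trajectory ends at `K⁻¹ = π/2` (robust form)

Topic `Literature/MathematicalPhysics/StatisticalMechanics`. Fifth file of the group
`KosterlitzThoulessStiffnessBound` · `KosterlitzRecursionFlow` · `KosterlitzRecursionFlowRobust` ·
`KosterlitzUniversalJumpRobust` · `KosterlitzRecursionFlowDichotomy`, completing the phase portrait
of flows of Kosterlitz type WITH higher-order corrections,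

  `A₁·y² ≤ dK⁻¹/dℓ ≤ A₂·y²`,   `|dy/dℓ - (2 - π·K)·y| ≤ C·y³`,   `y > 0`

(Nelson 2002, eqs. (2.61a,b) with their `O(y⁴)`, `O(y³)` corrections absorbed in two-sided
envelopes). `KosterlitzUniversalJumpRobust` derives the universal jump `ρ(T_c⁻) = (2/π)·T_c` from
the SEPARATRIX-END HYPOTHESIS "at `T_c` the trajectory runs into `K⁻¹ = π/2`". Here that
hypothesis is DERIVED from the phase-boundary characterisation of `T_c` — trajectories flow into
the fixed line (`y → 0`) for `T < T_c` and fail to for temperatures just above `T_c` — plus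
continuous dependence of the finite-scale couplings on `T`. The tool is the robust BASIN of
attraction of the stable fixed line: for `K > 2/π` and small fugacity the trajectory converges to
the fixed line exponentially and its stiffness stays bounded away from `2/π` (so the strictly
ordered regime is OPEN in the bare couplings); combined with the dichotomy of
`KosterlitzRecursionFlowDichotomy` this pins the `T_c` trajectory to the end point of the fixed line.

## What is PROVED

* `IsPerturbedFlowTrajectory.basin` — **the fixed line attracts for `K > 2/π`** (upper envelope
  `dK⁻¹/dℓ ≤ A₂·y²`): if at some scale `ℓ₀` one has `K⁻¹(ℓ₀) < u* < π/2` with the explicit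
  smallness `8C·y(ℓ₀)² ≤ κ` and `K⁻¹(ℓ₀) + 4A₂·y(ℓ₀)²/κ < u*`, `κ = π/u* - 2`, then for all
  `ℓ ≥ ℓ₀`: `K⁻¹(ℓ) < u*` and `y(ℓ) ≤ y(ℓ₀)·e^{-(κ/2)(ℓ-ℓ₀)}` (one first-exit bootstrap on the pair
  `y·e^{(κ/2)(ℓ-ℓ₀)} < 2y(ℓ₀)`, `K⁻¹ < u*`); `.tendsto_of_basin` — hence `y → 0` and
  `K⁻¹ → u_∞ < u*`, `K_R > 1/u* > 2/π`.
* `eventually_tendsto_fug_zero_of_lt` — **the strictly ordered regime is open in `T`**: for a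
  family `T ↦ (K_T⁻¹, y_T)` of such trajectories (uniform `C`, `A₂`) continuous in `T` at `T₀` at
  every fixed scale, if the `T₀` trajectory flows into the fixed line with `K_R > 2/π`, then so do
  the trajectories of all nearby `T` (the basin estimate at a late scale, transported by
  continuity).
* `tendsto_critical_of_phaseBoundary` — **the critical trajectory**: for a family
  `T ↦ (K_T⁻¹, y_T)` of such trajectories (uniform `C`, `A₁ > 0`, `A₂`) near `T_c`, continuous in
  `T` at `T_c` at every fixed scale, with `y_T → 0` for `T < T_c` near `T_c` and `y_T ↛ 0` for `T`
  arbitrarily close above `T_c`: the `T_c` trajectory itself flows into the fixed line, `y_{T_c} → 0`,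
  and runs into its END POINT, `K_{T_c}⁻¹(ℓ) → π/2` (if it stopped short of `π/2` the basin theorem
  and continuity would order a neighbourhood of `T_c`; if it passed `π/2` continuity would disorder
  temperatures below `T_c`).
* `universalJumpAt_of_phaseBoundary` — **the universal jump from the phase boundary**: with the
  identification `ρ(T)/T = lim_ℓ K_T(ℓ)` below `T_c` (Nelson 2002, eq. (2.70)),
  `KosterlitzThouless.UniversalJumpAt ρ T_c`; `eq_two_div_pi_mul_of_phaseBoundary` — and
  `ρ(T_c) = (2/π)·T_c` if the identification holds at `T_c` too.
* `universalJumpAt_of_isTransitionAt_of_flowFamily` — **the universal jump from the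
  identification alone**: if `ρ(T)/T` is the limit stiffness at every `T ≠ T_c` near `T_c` and `T_c`
  is the stiffness transition of `ρ` (`IsTransitionAt`: `ρ > 0` below, `= 0` above), the
  phase-boundary hypotheses are themselves derived (dichotomy) and `UniversalJumpAt ρ T_c` follows —
  so BOTH named hypotheses of `KosterlitzThoulessStiffnessBound` (`StableBelow` via
  `KosterlitzRecursionFlowDichotomy`, `UniversalJumpAt` here) follow from the identification of a
  measured stiffness curve with the limit stiffness of a continuous family of Kosterlitz-type flows;
  `not_continuousAt_of_isTransitionAt_of_flowFamily` — hence `ρ` is discontinuous at `T_c`.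

## Rigour status

Elementary real analysis on given families of trajectories; continuity in `T` of the finite-scale
couplings is a hypothesis (it is continuous dependence of the renormalisation trajectory on bare
couplings that vary continuously with `T`); no existence theorem for the flow is needed or claimed.
What remains a renormalisation-group HYPOTHESIS about a physical system is the flow description of
its stiffness: identification (2.70) and the phase-boundary reading of `T_c`. Nearest rigorous
counterpart in print, for ONE model: P. Falco, Commun. Math. Phys. 312 (2012) 559 (2D lattice Coulomb
gas at small activity; the exact multiscale flow ON the transition line is Kosterlitz's, stable
manifold theorem in a Banach space of irrelevant terms) — a different object (discrete scales, one
model, on the line only); nothing here is specific to a model.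

## References

* J. M. Kosterlitz, J. Phys. C 7 (1974) 1046. [Kosterlitz1974]
* D. R. Nelson, J. M. Kosterlitz, Phys. Rev. Lett. 39 (1977) 1201. [NelsonKosterlitz1977]
* D. R. Nelson, *Defects and Geometry in Condensed Matter Physics*, CUP 2002, §2.2.3,
  eqs. (2.61)–(2.62), (2.70)–(2.72), Figs. 2.6, 2.8. [Nelson2002Defects]
-/

noncomputable section

open Filter Topology Set Real

namespace Literature.MathematicalPhysics.StatisticalMechanics

namespace KosterlitzThouless

namespace IsPerturbedFlowTrajectory

variable {C : ℝ} {u y : ℝ → ℝ}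

/-! ## §1 The robust basin of attraction of the stable fixed line -/

/-- **The fixed line attracts for `K > 2/π` (robust basin).** Let the trajectory have the upper
envelope `dK⁻¹/dℓ ≤ A₂·y²` (`A₂ ≥ 0`), and at some scale `ℓ₀ ≥ 0` let `u* < π/2`, `κ := π/u* - 2 > 0`,
with the smallness conditions `8C·y(ℓ₀)² ≤ κ` (the `O(y³)` remainder is at most half the linear
restoring rate while `y ≤ 2y(ℓ₀)`) and `K⁻¹(ℓ₀) + 4A₂·y(ℓ₀)²/κ < u*` (the total drift of `K⁻¹`
driven by an exponentially decaying `y ≤ 2y(ℓ₀)e^{-(κ/2)(ℓ-ℓ₀)}` does not reach `u*`). Then for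
every `ℓ ≥ ℓ₀`: `K⁻¹(ℓ) < u*` and `y(ℓ) ≤ y(ℓ₀)·e^{-(κ/2)(ℓ-ℓ₀)}`. (First-exit argument on the open
conditions `y·e^{(κ/2)(ℓ-ℓ₀)} < 2y(ℓ₀)`, `K⁻¹ < u*`: while they hold, `y·e^{(κ/2)(ℓ-ℓ₀)}` and
`K⁻¹ + (4A₂y(ℓ₀)²/κ)·e^{-κ(ℓ-ℓ₀)}` are non-increasing, which keeps both conditions closed off from
failure.) This is the shaded domain of attraction of Nelson 2002, Fig. 2.6, for the un-truncated
equations, locally near the fixed line. [cite: Nelson2002Defects, §2.2.3 eqs. (2.61a,b), Fig. 2.6] -/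
theorem basin (h : IsPerturbedFlowTrajectory C u y) {A₂ : ℝ} (hA₂ : 0 ≤ A₂)
    (hu : ∀ ⦃l : ℝ⦄, 0 ≤ l → ∃ d : ℝ, HasDerivWithinAt u d (Ici 0) l ∧ d ≤ A₂ * y l ^ 2)
    {l₀ ustar : ℝ} (hl₀ : 0 ≤ l₀) (hustar : ustar < π / 2)
    (hsmall : 8 * C * y l₀ ^ 2 ≤ π / ustar - 2)
    (hdrift : u l₀ + 4 * A₂ * y l₀ ^ 2 / (π / ustar - 2) < ustar) :
    (∀ ⦃l : ℝ⦄, l₀ ≤ l → u l < ustar) ∧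
      ∀ ⦃l : ℝ⦄, l₀ ≤ l → y l ≤ y l₀ * Real.exp (-((π / ustar - 2) / 2) * (l - l₀)) := by
  have hπ : 0 < π := Real.pi_pos
  have hC : 0 ≤ C := h.coeff_nonneg
  have hy₀ : 0 < y l₀ := h.fug_pos hl₀
  have hul₀ : 0 < u l₀ := h.inv_pos_of_nonneg hl₀
  set κ : ℝ := π / ustar - 2 with hκdef
  -- `u* > 0` and `κ > 0`
  have hustar0 : 0 < ustar := by
    -- if `ustar ≤ 0` then `κ = π/ustar - 2 < 0 ≤ 8·C·y(ℓ₀)²`, contradicting `hsmall`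
    by_contra hneg
    push Not at hneg
    have h1 : π / ustar ≤ 0 := div_nonpos_of_nonneg_of_nonpos hπ.le hneg
    have h3 : 0 ≤ 8 * C * y l₀ ^ 2 := by positivity
    have hκneg : κ < 0 := by simp only [hκdef]; linarith
    linarith
  have hκ : 0 < κ := by
    have : 2 < π / ustar := by
      rw [lt_div_iff₀ hustar0]
      linarith
    simp only [hκdef]
    linarith
  have hdrift0 : 0 ≤ 4 * A₂ * y l₀ ^ 2 / κ := by positivity
  have hu₀ : u l₀ < ustar := by linarith
  -- abbreviations
  set y₀ : ℝ := y l₀ with hy₀def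
  set D : ℝ := 4 * A₂ * y₀ ^ 2 / κ with hDdef
  -- comparison functions
  set z : ℝ → ℝ := fun s => y s * Real.exp (κ / 2 * (s - l₀)) with hzdef
  set Φ : ℝ → ℝ := fun s => u s + D * Real.exp (-κ * (s - l₀)) with hΦdef
  -- derivative data
  have hzderiv : ∀ s, 0 ≤ s → ∃ d : ℝ, HasDerivWithinAt y d (Ici 0) s ∧
      |d - (2 - π / u s) * y s| ≤ C * y s ^ 3 ∧
      HasDerivWithinAt z ((d + κ / 2 * y s) * Real.exp (κ / 2 * (s - l₀))) (Ici 0) s := by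
    intro s hs
    obtain ⟨d, hd, hrem⟩ := h.hasDeriv_fug hs
    refine ⟨d, hd, hrem, ?_⟩
    have h1 : HasDerivWithinAt (fun x : ℝ => κ / 2 * (x - l₀)) (κ / 2 * 1) (Ici 0) s :=
      (((hasDerivAt_id s).sub_const l₀).const_mul (κ / 2)).hasDerivWithinAt
    have he : HasDerivWithinAt (fun x => Real.exp (κ / 2 * (x - l₀)))
        (Real.exp (κ / 2 * (s - l₀)) * (κ / 2 * 1)) (Ici 0) s := h1.exp
    refine (hd.mul he).congr_deriv ?_
    ring
  have hΦderiv : ∀ s, 0 ≤ s → ∃ d : ℝ, HasDerivWithinAt u d (Ici 0) s ∧ d ≤ A₂ * y s ^ 2 ∧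
      HasDerivWithinAt Φ (d + D * (Real.exp (-κ * (s - l₀)) * (-κ * 1))) (Ici 0) s := by
    intro s hs
    obtain ⟨d, hd, hle⟩ := hu hs
    refine ⟨d, hd, hle, ?_⟩
    have h1 : HasDerivWithinAt (fun x : ℝ => -κ * (x - l₀)) (-κ * 1) (Ici 0) s :=
      (((hasDerivAt_id s).sub_const l₀).const_mul (-κ)).hasDerivWithinAt
    have he : HasDerivWithinAt (fun x => Real.exp (-κ * (x - l₀)))
        (Real.exp (-κ * (s - l₀)) * (-κ * 1)) (Ici 0) s := h1.exp
    exact hd.add (he.const_mul D)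
  have hzcont : ContinuousOn z (Ici l₀) := by
    intro s hs
    have hs0 : 0 ≤ s := hl₀.trans (mem_Ici.1 hs)
    obtain ⟨d, -, -, hzd⟩ := hzderiv s hs0
    exact hzd.continuousWithinAt.mono (Ici_subset_Ici.2 hl₀)
  have hucont : ContinuousOn u (Ici l₀) := by
    intro s hs
    have hs0 : 0 ≤ s := hl₀.trans (mem_Ici.1 hs)
    obtain ⟨d, hd, -⟩ := hu hs0
    exact hd.continuousWithinAt.mono (Ici_subset_Ici.2 hl₀)
  have hΦcont : ContinuousOn Φ (Ici l₀) := by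
    intro s hs
    have hs0 : 0 ≤ s := hl₀.trans (mem_Ici.1 hs)
    obtain ⟨d, -, -, hΦd⟩ := hΦderiv s hs0
    exact hΦd.continuousWithinAt.mono (Ici_subset_Ici.2 hl₀)
  have hz₀ : z l₀ = y₀ := by simp [hzdef, hy₀def]
  have hΦ₀ : Φ l₀ = u l₀ + D := by simp [hΦdef]
  -- KEY STEP: if the open conditions hold on `[l₀, τ)`, then at `τ` they hold with room to spare
  have hkey : ∀ τ, l₀ ≤ τ → (∀ s, l₀ ≤ s → s < τ → z s < 2 * y₀ ∧ u s < ustar) →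
      z τ ≤ y₀ ∧ u τ + D * Real.exp (-κ * (τ - l₀)) ≤ u l₀ + D := by
    intro τ hτ hgood
    constructor
    · -- `z` is non-increasing on `[l₀, τ]`
      have hanti : AntitoneOn z (Icc l₀ τ) := by
        refine antitoneOn_of_deriv_nonpos (convex_Icc l₀ τ) (hzcont.mono Icc_subset_Ici_self) ?_ ?_
        · intro s hs
          rw [interior_Icc] at hs
          have hs0 : 0 < s := hl₀.trans_lt hs.1
          obtain ⟨d, -, -, hzd⟩ := hzderiv s hs0.le
          exact (hzd.hasDerivAt (Ici_mem_nhds hs0)).differentiableAt.differentiableWithinAt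
        · intro s hs
          rw [interior_Icc] at hs
          have hs0 : 0 < s := hl₀.trans_lt hs.1
          obtain ⟨d, hd, hrem, hzd⟩ := hzderiv s hs0.le
          rw [(hzd.hasDerivAt (Ici_mem_nhds hs0)).deriv]
          obtain ⟨hzs, hus⟩ := hgood s hs.1.le hs.2
          have hys : 0 < y s := h.fug_pos hs0.le
          have hus0 : 0 < u s := h.inv_pos_of_nonneg hs0.le
          -- `y s ≤ z s < 2 y₀`
          have hexp1 : 1 ≤ Real.exp (κ / 2 * (s - l₀)) := Real.one_le_exp (by nlinarith [hs.1.le])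
          have hyz : y s ≤ z s := by
            simp only [hzdef]
            exact le_mul_of_one_le_right hys.le hexp1
          have hy2 : y s < 2 * y₀ := lt_of_le_of_lt hyz hzs
          -- rate: `2 - π/u s ≤ -κ`
          have hrate : 2 - π / u s ≤ -κ := by
            have : π / ustar ≤ π / u s := div_le_div_of_nonneg_left hπ.le hus0 hus.le
            simp only [hκdef]
            linarith
          -- remainder: `C y² ≤ κ/2`
          have hrem2 : C * y s ^ 2 ≤ κ / 2 := by
            have h1 : y s ^ 2 ≤ (2 * y₀) ^ 2 := by nlinarith
            have h2 : C * y s ^ 2 ≤ C * (2 * y₀) ^ 2 := mul_le_mul_of_nonneg_left h1 hC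
            have h3 : C * (2 * y₀) ^ 2 = (8 * C * y₀ ^ 2) / 2 := by ring
            linarith [hsmall]
          have hdle : d ≤ (2 - π / u s) * y s + C * y s ^ 3 := by
            have := (abs_le.1 hrem).2
            linarith
          have h1 : (2 - π / u s) * y s ≤ -κ * y s := mul_le_mul_of_nonneg_right hrate hys.le
          have h2 : C * y s ^ 2 * y s ≤ κ / 2 * y s := mul_le_mul_of_nonneg_right hrem2 hys.le
          have h3 : C * y s ^ 3 = C * y s ^ 2 * y s := by ring
          have h4 : d + κ / 2 * y s ≤ 0 := by nlinarith
          exact mul_nonpos_of_nonpos_of_nonneg h4 (Real.exp_pos _).le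
      have := hanti ⟨le_rfl, hτ⟩ ⟨hτ, le_rfl⟩ hτ
      rw [hz₀] at this
      exact this
    · -- `Φ` is non-increasing on `[l₀, τ]`
      have hanti : AntitoneOn Φ (Icc l₀ τ) := by
        refine antitoneOn_of_deriv_nonpos (convex_Icc l₀ τ) (hΦcont.mono Icc_subset_Ici_self) ?_ ?_
        · intro s hs
          rw [interior_Icc] at hs
          have hs0 : 0 < s := hl₀.trans_lt hs.1
          obtain ⟨d, -, -, hΦd⟩ := hΦderiv s hs0.le
          exact (hΦd.hasDerivAt (Ici_mem_nhds hs0)).differentiableAt.differentiableWithinAt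
        · intro s hs
          rw [interior_Icc] at hs
          have hs0 : 0 < s := hl₀.trans_lt hs.1
          obtain ⟨d, hd, hle, hΦd⟩ := hΦderiv s hs0.le
          rw [(hΦd.hasDerivAt (Ici_mem_nhds hs0)).deriv]
          obtain ⟨hzs, -⟩ := hgood s hs.1.le hs.2
          have hys : 0 < y s := h.fug_pos hs0.le
          -- `y s = z s · e^{-(κ/2)(s-l₀)}`, so `y s² ≤ 4 y₀² e^{-κ(s-l₀)}`
          have hzs0 : 0 < z s := by simp only [hzdef]; positivity
          have hz2 : z s ^ 2 ≤ (2 * y₀) ^ 2 := by nlinarith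
          have hysq : y s ^ 2 = z s ^ 2 * Real.exp (-κ * (s - l₀)) := by
            simp only [hzdef]
            rw [mul_pow, ← Real.exp_nat_mul, mul_assoc, ← Real.exp_add]
            ring_nf
            simp
          have h1 : A₂ * y s ^ 2 ≤ A₂ * ((2 * y₀) ^ 2 * Real.exp (-κ * (s - l₀))) := by
            rw [hysq]
            exact mul_le_mul_of_nonneg_left
              (mul_le_mul_of_nonneg_right hz2 (Real.exp_pos _).le) hA₂
          have h2 : D * (Real.exp (-κ * (s - l₀)) * (-κ * 1)) =
              -(A₂ * ((2 * y₀) ^ 2 * Real.exp (-κ * (s - l₀)))) := by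
            simp only [hDdef]
            field_simp
            ring
          rw [h2]
          linarith
      have := hanti ⟨le_rfl, hτ⟩ ⟨hτ, le_rfl⟩ hτ
      rw [hΦ₀] at this
      simpa [hΦdef] using this
  -- FIRST-EXIT ARGUMENT: the open conditions never fail on `[l₀, ∞)`
  have hnever : ∀ s, l₀ ≤ s → z s < 2 * y₀ ∧ u s < ustar := by
    by_contra hfail
    push Not at hfail
    -- the (closed) set of failure times
    set B : Set ℝ := (Ici l₀ ∩ z ⁻¹' Ici (2 * y₀)) ∪ (Ici l₀ ∩ u ⁻¹' Ici ustar) with hB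
    have hBclosed : IsClosed B :=
      (hzcont.preimage_isClosed_of_isClosed isClosed_Ici isClosed_Ici).union
        (hucont.preimage_isClosed_of_isClosed isClosed_Ici isClosed_Ici)
    have hBne : B.Nonempty := by
      obtain ⟨s, hs, hbad⟩ := hfail
      by_cases hzs : z s < 2 * y₀
      · exact ⟨s, Or.inr ⟨hs, mem_preimage.2 (mem_Ici.2 (hbad hzs))⟩⟩
      · exact ⟨s, Or.inl ⟨hs, mem_preimage.2 (mem_Ici.2 (not_lt.1 hzs))⟩⟩
    have hBbdd : BddBelow B := ⟨l₀, fun s hs => by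
      rcases hs with ⟨hs, -⟩ | ⟨hs, -⟩ <;> exact hs⟩
    have hτB : sInf B ∈ B := hBclosed.csInf_mem hBne hBbdd
    set τ : ℝ := sInf B with hτ
    have hτl₀ : l₀ ≤ τ := by
      rcases hτB with ⟨hs, -⟩ | ⟨hs, -⟩ <;> exact hs
    -- before `τ` the conditions hold
    have hgood : ∀ s, l₀ ≤ s → s < τ → z s < 2 * y₀ ∧ u s < ustar := by
      intro s hs hsτ
      by_contra hbad
      have hsB : s ∈ B := by
        by_cases hzs : z s < 2 * y₀
        · have hus : ¬ u s < ustar := fun hus => hbad ⟨hzs, hus⟩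
          exact Or.inr ⟨hs, mem_preimage.2 (mem_Ici.2 (not_lt.1 hus))⟩
        · exact Or.inl ⟨hs, mem_preimage.2 (mem_Ici.2 (not_lt.1 hzs))⟩
      have : τ ≤ s := csInf_le hBbdd hsB
      linarith
    -- hence at `τ` they hold with room to spare: `τ ∉ B`
    obtain ⟨hzτ, huτ⟩ := hkey τ hτl₀ hgood
    have hexpτ : 0 < D * Real.exp (-κ * (τ - l₀)) ∨ D = 0 := by
      rcases eq_or_lt_of_le (show 0 ≤ D by positivity) with hD | hD
      · exact Or.inr hD.symm
      · exact Or.inl (mul_pos hD (Real.exp_pos _))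
    have huτ' : u τ < ustar := by
      rcases hexpτ with hpos | hD0
      · linarith
      · -- `D = 0`: then `u τ ≤ u l₀ < ustar`
        have : u τ ≤ u l₀ := by
          have := huτ
          rw [hD0] at this
          simpa using this
        linarith
    have hzτ' : z τ < 2 * y₀ := by linarith
    rcases hτB with ⟨-, hz⟩ | ⟨-, hu'⟩
    · exact absurd (mem_Ici.1 (mem_preimage.1 hz)) (not_le.2 hzτ')
    · exact absurd (mem_Ici.1 (mem_preimage.1 hu')) (not_le.2 huτ')
  -- conclusions
  refine ⟨fun l hl => (hnever l hl).2, fun l hl => ?_⟩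
  have hzl : z l ≤ y₀ := (hkey l hl fun s hs hsl => hnever s hs).1
  have hexp : 0 < Real.exp (κ / 2 * (l - l₀)) := Real.exp_pos _
  -- `y l = z l · e^{-(κ/2)(l-l₀)}`
  have hyl : y l = z l * Real.exp (-(κ / 2) * (l - l₀)) := by
    simp only [hzdef]
    rw [mul_assoc, ← Real.exp_add]
    ring_nf
    simp
  rw [hyl]
  exact mul_le_mul_of_nonneg_right hzl (Real.exp_pos _).le

/-- **Consequences of the basin estimate**: under the hypotheses of `basin` the fugacity
renormalises to zero and the inverse stiffness converges to a limit `u_∞ < u* < π/2` — the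
trajectory is STRICTLY ordered, `K_R > 1/u* > 2/π`.
[cite: Nelson2002Defects, §2.2.3 eqs. (2.61a,b), (2.70), Fig. 2.6] -/
theorem tendsto_of_basin (h : IsPerturbedFlowTrajectory C u y) {A₂ : ℝ} (hA₂ : 0 ≤ A₂)
    (hu : ∀ ⦃l : ℝ⦄, 0 ≤ l → ∃ d : ℝ, HasDerivWithinAt u d (Ici 0) l ∧ d ≤ A₂ * y l ^ 2)
    {l₀ ustar : ℝ} (hl₀ : 0 ≤ l₀) (hustar : ustar < π / 2)
    (hsmall : 8 * C * y l₀ ^ 2 ≤ π / ustar - 2)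
    (hdrift : u l₀ + 4 * A₂ * y l₀ ^ 2 / (π / ustar - 2) < ustar) :
    Tendsto y atTop (𝓝 0) ∧ ∃ uinf : ℝ, uinf < ustar ∧ Tendsto u atTop (𝓝 uinf) := by
  obtain ⟨hult, hyle⟩ := h.basin hA₂ hu hl₀ hustar hsmall hdrift
  have hπ : 0 < π := Real.pi_pos
  have hy₀ : 0 < y l₀ := h.fug_pos hl₀
  have hul₀ : 0 < u l₀ := h.inv_pos_of_nonneg hl₀
  have hC : 0 ≤ C := h.coeff_nonneg
  have hustar0 : 0 < ustar := by
    by_contra hneg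
    push Not at hneg
    have h1 : π / ustar ≤ 0 := div_nonpos_of_nonneg_of_nonpos hπ.le hneg
    have h3 : 0 ≤ 8 * C * y l₀ ^ 2 := by positivity
    linarith
  have hκ : 0 < π / ustar - 2 := by
    have : 2 < π / ustar := by
      rw [lt_div_iff₀ hustar0]
      linarith
    linarith
  -- `y → 0` by the exponential bound
  have hy : Tendsto y atTop (𝓝 0) := by
    have hdecay : Tendsto (fun l => y l₀ * Real.exp (-((π / ustar - 2) / 2) * (l - l₀))) atTop
        (𝓝 (y l₀ * 0)) := by
      refine tendsto_const_nhds.mul ?_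
      refine Real.tendsto_exp_atBot.comp ?_
      have h1 : Tendsto (fun l : ℝ => l - l₀) atTop atTop := tendsto_atTop_add_const_right _ _ tendsto_id
      have h2 := h1.const_mul_atTop_of_neg (show -((π / ustar - 2) / 2) < 0 by linarith)
      exact h2
    rw [mul_zero] at hdecay
    refine tendsto_of_tendsto_of_tendsto_of_le_of_le' tendsto_const_nhds hdecay ?_ ?_
    · filter_upwards [eventually_ge_atTop l₀] with l hl using (h.fug_pos (hl₀.trans hl)).le
    · filter_upwards [eventually_ge_atTop l₀] with l hl using hyle hl
  refine ⟨hy, ?_⟩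
  obtain ⟨uinf, -, -, hulim⟩ := h.exists_tendsto_of_tendsto_fug_zero hy
  -- `uinf ≤ u l₀ + drift·(anything) < ustar`: use the basin bound `u l < ustar` and a margin
  -- from the monotone structure: `u l ≤ Φ-type bound`; simplest: `uinf ≤ sup ≤ ustar`, strictness via
  -- the drift bound at `l₀`: apply `basin` with a slightly smaller `u*`.
  -- Choose `u' ∈ (u l₀ + drift, ustar)`; the hypotheses of `basin` are monotone in `u*`.
  set u' : ℝ := (u l₀ + 4 * A₂ * y l₀ ^ 2 / (π / ustar - 2) + ustar) / 2 with hu'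
  have hu'lt : u' < ustar := by rw [hu']; linarith
  have hu'gt : u l₀ + 4 * A₂ * y l₀ ^ 2 / (π / ustar - 2) < u' := by rw [hu']; linarith
  have hu'0 : 0 < u' := by
    have : 0 ≤ 4 * A₂ * y l₀ ^ 2 / (π / ustar - 2) := by positivity
    linarith
  have hκ' : π / ustar - 2 ≤ π / u' - 2 := by
    have : π / ustar ≤ π / u' := div_le_div_of_nonneg_left hπ.le hu'0 hu'lt.le
    linarith
  have hκ'pos : 0 < π / u' - 2 := lt_of_lt_of_le hκ hκ'
  have hsmall' : 8 * C * y l₀ ^ 2 ≤ π / u' - 2 := hsmall.trans hκ'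
  have hdrift' : u l₀ + 4 * A₂ * y l₀ ^ 2 / (π / u' - 2) < u' := by
    have : 4 * A₂ * y l₀ ^ 2 / (π / u' - 2) ≤ 4 * A₂ * y l₀ ^ 2 / (π / ustar - 2) :=
      div_le_div_of_nonneg_left (by positivity) hκ hκ'
    linarith
  obtain ⟨hult', -⟩ := h.basin hA₂ hu hl₀ (hu'lt.trans hustar) hsmall' hdrift'
  refine ⟨uinf, lt_of_le_of_lt ?_ hu'lt, hulim⟩
  refine le_of_tendsto hulim ?_
  filter_upwards [eventually_ge_atTop l₀] with l hl using (hult' hl).le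

end IsPerturbedFlowTrajectory

/-! ## §2 The strictly ordered regime is open in the temperature -/

/-- **Openness of the strictly ordered regime.** Let `T ↦ (K_T⁻¹, y_T)` be a family of
Kosterlitz-type trajectories near `T₀` with uniform remainder constant `C` and upper envelope
`dK⁻¹/dℓ ≤ A₂·y²`, continuous in `T` at `T₀` at every fixed scale. If the `T₀` trajectory flows into
the fixed line (`y_{T₀} → 0`) with limit inverse stiffness `u_∞ < π/2` (STRICTLY ordered,
`K_R > 2/π`), then every temperature near `T₀` is ordered: `y_T → 0`. (At a late scale the `T₀` data
sit inside the robust basin with room to spare; by continuity so do the data of nearby `T`.)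
[cite: Nelson2002Defects, §2.2.3 eqs. (2.61a,b), Fig. 2.6] -/
theorem eventually_tendsto_fug_zero_of_lt {C A₂ T₀ : ℝ} {u y : ℝ → ℝ → ℝ} (hA₂ : 0 ≤ A₂)
    (hflow : ∀ᶠ T in 𝓝 T₀, IsPerturbedFlowTrajectory C (u T) (y T) ∧
      ∀ ⦃l : ℝ⦄, 0 ≤ l → ∃ d : ℝ, HasDerivWithinAt (u T) d (Ici 0) l ∧ d ≤ A₂ * y T l ^ 2)
    (hcont : ∀ ⦃l : ℝ⦄, 0 ≤ l →
      ContinuousAt (fun T => u T l) T₀ ∧ ContinuousAt (fun T => y T l) T₀)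
    (hy₀ : Tendsto (y T₀) atTop (𝓝 0)) {uinf : ℝ} (hu₀ : Tendsto (u T₀) atTop (𝓝 uinf))
    (hlt : uinf < π / 2) :
    ∀ᶠ T in 𝓝 T₀, Tendsto (y T) atTop (𝓝 0) := by
  have hπ : 0 < π := Real.pi_pos
  obtain ⟨hcrit, -⟩ := hflow.self_of_nhds
  have huinf_pos : 0 < uinf := hcrit.inv_pos.trans_le (hcrit.inv_le_of_tendsto hu₀ le_rfl)
  -- an intermediate target `u*` and its rate `κ`
  set ustar : ℝ := (uinf + π / 2) / 2 with hustar
  have hustar_lt : ustar < π / 2 := by rw [hustar]; linarith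
  have hustar_gt : uinf < ustar := by rw [hustar]; linarith
  have hustar0 : 0 < ustar := huinf_pos.trans hustar_gt
  set κ : ℝ := π / ustar - 2 with hκ
  have hκpos : 0 < κ := by
    have : 2 < π / ustar := by
      rw [lt_div_iff₀ hustar0]
      linarith
    simp only [hκ]
    linarith
  -- along the `T₀` trajectory the two basin quantities tend to `0` resp. `uinf < ustar`
  have hF : Tendsto (fun l => 8 * C * y T₀ l ^ 2) atTop (𝓝 0) := by
    have := (hy₀.pow 2).const_mul (8 * C)
    simpa using this
  have hG : Tendsto (fun l => u T₀ l + 4 * A₂ * y T₀ l ^ 2 / κ) atTop (𝓝 uinf) := by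
    have h1 : Tendsto (fun l => 4 * A₂ * y T₀ l ^ 2 / κ) atTop (𝓝 (4 * A₂ * 0 ^ 2 / κ)) :=
      ((hy₀.pow 2).const_mul (4 * A₂)).div_const κ
    simp only [zero_pow two_ne_zero, mul_zero, zero_div] at h1
    have := hu₀.add h1
    simpa using this
  obtain ⟨L₁, hL₁⟩ := eventually_atTop.1 ((tendsto_order.1 hF).2 κ hκpos)
  obtain ⟨L₂, hL₂⟩ := eventually_atTop.1 ((tendsto_order.1 hG).2 ustar hustar_gt)
  set lstar : ℝ := max (max L₁ L₂) 0 with hlstar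
  have hlstar0 : 0 ≤ lstar := le_max_right _ _
  have hFl : 8 * C * y T₀ lstar ^ 2 < κ := hL₁ lstar ((le_max_left L₁ L₂).trans (le_max_left _ _))
  have hGl : u T₀ lstar + 4 * A₂ * y T₀ lstar ^ 2 / κ < ustar :=
    hL₂ lstar ((le_max_right L₁ L₂).trans (le_max_left _ _))
  -- by continuity in `T` at the fixed scale `lstar`, the same strict inequalities hold near `T₀`
  obtain ⟨hcu, hcy⟩ := hcont hlstar0
  have hFT : ∀ᶠ T in 𝓝 T₀, 8 * C * y T lstar ^ 2 < κ := by
    have hc : ContinuousAt (fun T => 8 * C * y T lstar ^ 2) T₀ := (hcy.pow 2).const_mul (8 * C)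
    exact hc.eventually (gt_mem_nhds hFl)
  have hGT : ∀ᶠ T in 𝓝 T₀, u T lstar + 4 * A₂ * y T lstar ^ 2 / κ < ustar := by
    have hc : ContinuousAt (fun T => u T lstar + 4 * A₂ * y T lstar ^ 2 / κ) T₀ :=
      hcu.add (((hcy.pow 2).const_mul (4 * A₂)).div_const κ)
    exact hc.eventually (gt_mem_nhds hGl)
  filter_upwards [hflow, hFT, hGT] with T hT hF' hG'
  exact (hT.1.tendsto_of_basin hA₂ hT.2 hlstar0 hustar_lt hF'.le hG').1

/-! ## §3 The critical trajectory runs into the end point of the fixed line -/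

/-- **The critical trajectory.** Let `T ↦ (K_T⁻¹, y_T)` be a family of Kosterlitz-type
trajectories near `T_c` with uniform remainder constant `C` and two-sided envelopes
`A₁·y² ≤ dK⁻¹/dℓ ≤ A₂·y²` (`A₁ > 0`), such that at every fixed scale `ℓ ≥ 0` the couplings
`K_T⁻¹(ℓ)`, `y_T(ℓ)` are continuous in `T` at `T_c`, and let `T_c` SEPARATE the flow-ordered
temperatures from the disordered ones: `y_T(ℓ) → 0` for all `T < T_c` close to `T_c`, while for
`T` arbitrarily close above `T_c` the fugacity does not renormalise to zero. Then the `T_c`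
trajectory flows into the fixed line, `y_{T_c}(ℓ) → 0`, and runs into its END POINT:
`K_{T_c}⁻¹(ℓ) → π/2`. (If `K_{T_c}⁻¹` passed `π/2` at some scale, continuity would make
`K_T⁻¹` pass it for `T < T_c`, contradicting robust stability there; so `K_{T_c}⁻¹` is bounded,
converges, and `y_{T_c} → 0` by the dichotomy; if its limit were `< π/2`, the strictly ordered
regime — open in `T` — would contain temperatures above `T_c`.) This is the statement that the
locus of bare couplings crosses the incoming separatrix of Nelson 2002, Fig. 2.6 exactly at `T_c`,
for the un-truncated equations. [cite: Nelson2002Defects, §2.2.3 eqs. (2.61)–(2.62), (2.70)–(2.71), Fig. 2.6] -/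
theorem tendsto_critical_of_phaseBoundary {C A₁ A₂ Tc : ℝ} {u y : ℝ → ℝ → ℝ}
    (hA₁ : 0 < A₁) (hA₂ : 0 ≤ A₂)
    (hflow : ∀ᶠ T in 𝓝 Tc, IsPerturbedFlowTrajectory C (u T) (y T) ∧
      ∀ ⦃l : ℝ⦄, 0 ≤ l → ∃ d : ℝ, HasDerivWithinAt (u T) d (Ici 0) l ∧
        A₁ * y T l ^ 2 ≤ d ∧ d ≤ A₂ * y T l ^ 2)
    (hord : ∀ᶠ T in 𝓝[<] Tc, Tendsto (y T) atTop (𝓝 0))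
    (hdis : ∃ᶠ T in 𝓝[>] Tc, ¬ Tendsto (y T) atTop (𝓝 0))
    (hcont : ∀ ⦃l : ℝ⦄, 0 ≤ l →
      ContinuousAt (fun T => u T l) Tc ∧ ContinuousAt (fun T => y T l) Tc) :
    Tendsto (y Tc) atTop (𝓝 0) ∧ Tendsto (u Tc) atTop (𝓝 (π / 2)) := by
  -- the `T_c` trajectory itself
  obtain ⟨hcrit, henv⟩ := hflow.self_of_nhds
  have hcritA₁ : ∀ ⦃l : ℝ⦄, 0 ≤ l → ∃ d : ℝ, HasDerivWithinAt (u Tc) d (Ici 0) l ∧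
      A₁ * y Tc l ^ 2 ≤ d := fun l hl => by
    obtain ⟨d, hd, h1, -⟩ := henv hl
    exact ⟨d, hd, h1⟩
  -- Step 1: `u Tc l ≤ π/2` for every `l ≥ 0`
  have hle : ∀ l, 0 ≤ l → u Tc l ≤ π / 2 := by
    intro l hl
    by_contra hgt
    push Not at hgt
    have hev : ∀ᶠ T in 𝓝 Tc, π / 2 < u T l := (hcont hl).1.eventually (lt_mem_nhds hgt)
    have hev' : ∀ᶠ T in 𝓝[<] Tc, π / 2 < u T l := nhdsWithin_le_nhds hev
    have hflow' : ∀ᶠ T in 𝓝[<] Tc, IsPerturbedFlowTrajectory C (u T) (y T) ∧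
        ∀ ⦃l : ℝ⦄, 0 ≤ l → ∃ d : ℝ, HasDerivWithinAt (u T) d (Ici 0) l ∧
          A₁ * y T l ^ 2 ≤ d ∧ d ≤ A₂ * y T l ^ 2 := nhdsWithin_le_nhds hflow
    obtain ⟨T, hT, hyT, hflT⟩ := (hev'.and (hord.and hflow')).exists
    exact hflT.1.not_tendsto_fug_zero_of_lt_inv hl hT hyT
  -- Step 2: `u Tc` converges (it cannot diverge) and `y Tc → 0` by the dichotomy
  have hconv : ∃ uinf : ℝ, u Tc 0 ≤ uinf ∧ Tendsto (u Tc) atTop (𝓝 uinf) := by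
    rcases hcrit.exists_tendsto_or_tendsto_atTop with hfin | htop
    · exact hfin
    · exfalso
      obtain ⟨L, hL⟩ := eventually_atTop.1 (htop.eventually_gt_atTop (π / 2))
      have h1 := hL (max L 0) (le_max_left L 0)
      have h2 := hle (max L 0) (le_max_right L 0)
      linarith
  obtain ⟨uinf, -, hulim⟩ := hconv
  have hycrit : Tendsto (y Tc) atTop (𝓝 0) := hcrit.tendsto_fug_zero_of_tendsto_inv hA₁ hcritA₁ hulim
  refine ⟨hycrit, ?_⟩
  have huinf_le : uinf ≤ π / 2 :=
    le_of_tendsto hulim (by filter_upwards [eventually_ge_atTop (0 : ℝ)] with l hl using hle l hl)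
  -- Step 3: `uinf = π/2`
  suffices huinf : uinf = π / 2 by rw [← huinf]; exact hulim
  by_contra hne
  have hlt : uinf < π / 2 := lt_of_le_of_ne huinf_le hne
  -- the strictly ordered regime would be open around `T_c`, ordering temperatures above `T_c`
  have hflowA₂ : ∀ᶠ T in 𝓝 Tc, IsPerturbedFlowTrajectory C (u T) (y T) ∧
      ∀ ⦃l : ℝ⦄, 0 ≤ l → ∃ d : ℝ, HasDerivWithinAt (u T) d (Ici 0) l ∧ d ≤ A₂ * y T l ^ 2 := by
    filter_upwards [hflow] with T hT
    refine ⟨hT.1, fun l hl => ?_⟩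
    obtain ⟨d, hd, -, h2⟩ := hT.2 hl
    exact ⟨d, hd, h2⟩
  have hall : ∀ᶠ T in 𝓝 Tc, Tendsto (y T) atTop (𝓝 0) :=
    eventually_tendsto_fug_zero_of_lt hA₂ hflowA₂ hcont hycrit hulim hlt
  have habove : ∀ᶠ T in 𝓝[>] Tc, Tendsto (y T) atTop (𝓝 0) := nhdsWithin_le_nhds hall
  exact (hdis.and_eventually habove).exists.elim fun T hT => hT.1 hT.2

/-! ## §4 The universal jump from the phase boundary -/

/-- **The Nelson–Kosterlitz universal jump from the phase boundary — robust form.** For a family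
of Kosterlitz-type trajectories as in `tendsto_critical_of_phaseBoundary` (uniform `C`, two-sided
envelopes, continuity in `T` at `T_c > 0` at every scale, `T_c` separating flow-ordered from
disordered temperatures) and a stiffness profile `ρ` identified below `T_c` with the limit stiffness,
`ρ(T)/T = lim_ℓ K_T(ℓ)` (Nelson 2002, eq. (2.70)): `ρ(T) → (2/π)·T_c` as `T → T_c⁻`, i.e.
`KosterlitzThouless.UniversalJumpAt ρ T_c` — with no truncation of the recursion relations, no
first integral, and the separatrix-end hypothesis of `universalJumpAt_of_robustFlowFamily` DERIVED.
[cite: Nelson2002Defects, §2.2.3 eqs. (2.70)–(2.72), Figs. 2.6, 2.8] -/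
theorem universalJumpAt_of_phaseBoundary {C A₁ A₂ Tc : ℝ} {u y : ℝ → ℝ → ℝ} {ρ : ℝ → ℝ}
    (hTc : 0 < Tc) (hA₁ : 0 < A₁) (hA₂ : 0 ≤ A₂)
    (hflow : ∀ᶠ T in 𝓝 Tc, IsPerturbedFlowTrajectory C (u T) (y T) ∧
      ∀ ⦃l : ℝ⦄, 0 ≤ l → ∃ d : ℝ, HasDerivWithinAt (u T) d (Ici 0) l ∧
        A₁ * y T l ^ 2 ≤ d ∧ d ≤ A₂ * y T l ^ 2)
    (hord : ∀ᶠ T in 𝓝[<] Tc, Tendsto (y T) atTop (𝓝 0))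
    (hdis : ∃ᶠ T in 𝓝[>] Tc, ¬ Tendsto (y T) atTop (𝓝 0))
    (hcont : ∀ ⦃l : ℝ⦄, 0 ≤ l →
      ContinuousAt (fun T => u T l) Tc ∧ ContinuousAt (fun T => y T l) Tc)
    (hid : ∀ᶠ T in 𝓝[<] Tc, Tendsto (fun l => (u T l)⁻¹) atTop (𝓝 (ρ T / T))) :
    UniversalJumpAt ρ Tc := by
  obtain ⟨-, hsep⟩ := tendsto_critical_of_phaseBoundary hA₁ hA₂ hflow hord hdis hcont
  have hflow' : ∀ᶠ T in 𝓝[<] Tc, IsPerturbedFlowTrajectory C (u T) (y T) ∧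
      ∀ ⦃l : ℝ⦄, 0 ≤ l → ∃ d : ℝ, HasDerivWithinAt (u T) d (Ici 0) l ∧
        A₁ * y T l ^ 2 ≤ d ∧ d ≤ A₂ * y T l ^ 2 := nhdsWithin_le_nhds hflow
  refine universalJumpAt_of_robustFlowFamily_of_tendsto hTc (fun _ => C) u y ?_ hsep ?_
  · filter_upwards [hflow', hord, hid] with T hT hy hi
    exact ⟨hT.1, hy, hi⟩
  · intro l hl
    exact ((hcont hl).1.tendsto).mono_left nhdsWithin_le_nhds

/-- **At `T_c` the stiffness is the universal value**: under the same hypotheses, if the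
identification holds at `T_c` itself (`ρ(T_c)/T_c = lim_ℓ K_{T_c}(ℓ)`), then
`ρ(T_c) = (2/π)·T_c`. [cite: Nelson2002Defects, §2.2.3 eqs. (2.71)–(2.72), Fig. 2.8] -/
theorem eq_two_div_pi_mul_of_phaseBoundary {C A₁ A₂ Tc : ℝ} {u y : ℝ → ℝ → ℝ} {ρ : ℝ → ℝ}
    (hTc : 0 < Tc) (hA₁ : 0 < A₁) (hA₂ : 0 ≤ A₂)
    (hflow : ∀ᶠ T in 𝓝 Tc, IsPerturbedFlowTrajectory C (u T) (y T) ∧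
      ∀ ⦃l : ℝ⦄, 0 ≤ l → ∃ d : ℝ, HasDerivWithinAt (u T) d (Ici 0) l ∧
        A₁ * y T l ^ 2 ≤ d ∧ d ≤ A₂ * y T l ^ 2)
    (hord : ∀ᶠ T in 𝓝[<] Tc, Tendsto (y T) atTop (𝓝 0))
    (hdis : ∃ᶠ T in 𝓝[>] Tc, ¬ Tendsto (y T) atTop (𝓝 0))
    (hcont : ∀ ⦃l : ℝ⦄, 0 ≤ l →
      ContinuousAt (fun T => u T l) Tc ∧ ContinuousAt (fun T => y T l) Tc)
    (hidc : Tendsto (fun l => (u Tc l)⁻¹) atTop (𝓝 (ρ Tc / Tc))) : ρ Tc = 2 / π * Tc := by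
  obtain ⟨-, hsep⟩ := tendsto_critical_of_phaseBoundary hA₁ hA₂ hflow hord hdis hcont
  exact eq_two_div_pi_mul_of_tendsto hTc hsep hidc

/-! ## §5 The universal jump with `T_c` read off the stiffness curve -/

/-- **The Nelson–Kosterlitz universal jump from the identification alone.** Let `T ↦ (K_T⁻¹, y_T)`
be a family of Kosterlitz-type trajectories near `T_c > 0` (uniform `C`, two-sided envelopes
`A₁·y² ≤ dK⁻¹/dℓ ≤ A₂·y²` with `A₁ > 0`, continuous in `T` at `T_c` at every fixed scale), let the
stiffness profile `ρ` be IDENTIFIED with the limit stiffness at every `T ≠ T_c` near `T_c`,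
`ρ(T)/T = lim_ℓ K_T(ℓ)` (Nelson 2002, eq. (2.70), now on both sides of `T_c`), and let `T_c` be the
stiffness transition of `ρ` in the sense of `KosterlitzThouless.IsTransitionAt` (`ρ > 0` below,
`ρ = 0` above — how `T_c` is read off a measured superfluid density, Nelson 2002 §6.2). Then
`ρ(T) → (2/π)·T_c` as `T → T_c⁻`: `KosterlitzThouless.UniversalJumpAt ρ T_c`. The phase-boundary
hypotheses of `universalJumpAt_of_phaseBoundary` are DERIVED: below `T_c` a positive limit stiffness
forces `y_T → 0` (dichotomy), above `T_c` a vanishing one forces `K_T⁻¹ → ∞` and `y_T ↛ 0`.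
Together with `stableBelow_of_isTransitionAt_of_robustFlowLimit` (`KosterlitzRecursionFlowDichotomy`):
BOTH named hypotheses of `KosterlitzThoulessStiffnessBound` follow from the identification of a
measured stiffness curve with the limit stiffness of a continuous family of Kosterlitz-type flows.
[cite: Nelson2002Defects, §2.2.3 eqs. (2.70)–(2.72), Fig. 2.8; §6.2 Fig. 6.2] -/
theorem universalJumpAt_of_isTransitionAt_of_flowFamily {C A₁ A₂ Tc : ℝ} {u y : ℝ → ℝ → ℝ}
    {ρ : ℝ → ℝ} (hTc : 0 < Tc) (hA₁ : 0 < A₁) (hA₂ : 0 ≤ A₂)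
    (hflow : ∀ᶠ T in 𝓝 Tc, IsPerturbedFlowTrajectory C (u T) (y T) ∧
      ∀ ⦃l : ℝ⦄, 0 ≤ l → ∃ d : ℝ, HasDerivWithinAt (u T) d (Ici 0) l ∧
        A₁ * y T l ^ 2 ≤ d ∧ d ≤ A₂ * y T l ^ 2)
    (hcont : ∀ ⦃l : ℝ⦄, 0 ≤ l →
      ContinuousAt (fun T => u T l) Tc ∧ ContinuousAt (fun T => y T l) Tc)
    (hTr : IsTransitionAt ρ Tc)
    (hid : ∀ᶠ T in 𝓝 Tc, T ≠ Tc → Tendsto (fun l => (u T l)⁻¹) atTop (𝓝 (ρ T / T))) :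
    UniversalJumpAt ρ Tc := by
  -- lower envelope alone, for the dichotomy
  have hflowA₁ : ∀ᶠ T in 𝓝 Tc, IsPerturbedFlowTrajectory C (u T) (y T) ∧
      ∀ ⦃l : ℝ⦄, 0 ≤ l → ∃ d : ℝ, HasDerivWithinAt (u T) d (Ici 0) l ∧ A₁ * y T l ^ 2 ≤ d := by
    filter_upwards [hflow] with T hT
    refine ⟨hT.1, fun l hl => ?_⟩
    obtain ⟨d, hd, h1, -⟩ := hT.2 hl
    exact ⟨d, hd, h1⟩
  -- below `T_c`: positive stiffness ⇒ the trajectory flows into the fixed line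
  have hord : ∀ᶠ T in 𝓝[<] Tc, Tendsto (y T) atTop (𝓝 0) := by
    have h1 : ∀ᶠ T in 𝓝[<] Tc, IsPerturbedFlowTrajectory C (u T) (y T) ∧
        ∀ ⦃l : ℝ⦄, 0 ≤ l → ∃ d : ℝ, HasDerivWithinAt (u T) d (Ici 0) l ∧ A₁ * y T l ^ 2 ≤ d :=
      nhdsWithin_le_nhds hflowA₁
    have h2 : ∀ᶠ T in 𝓝[<] Tc, T ≠ Tc → Tendsto (fun l => (u T l)⁻¹) atTop (𝓝 (ρ T / T)) :=
      nhdsWithin_le_nhds hid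
    filter_upwards [h1, h2, Ioo_mem_nhdsLT hTc] with T hT hi hTI
    have hq : 0 < ρ T / T := div_pos (hTr.1 hTI.1 hTI.2) hTI.1
    exact (hT.1.two_div_pi_le_of_tendsto_stiffness_pos hA₁ hT.2 hq (hi hTI.2.ne)).2
  -- above `T_c`: vanishing stiffness ⇒ `K⁻¹ → ∞` ⇒ the fugacity does not renormalise to zero
  have hdis : ∀ᶠ T in 𝓝[>] Tc, ¬ Tendsto (y T) atTop (𝓝 0) := by
    have h1 : ∀ᶠ T in 𝓝[>] Tc, IsPerturbedFlowTrajectory C (u T) (y T) ∧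
        ∀ ⦃l : ℝ⦄, 0 ≤ l → ∃ d : ℝ, HasDerivWithinAt (u T) d (Ici 0) l ∧ A₁ * y T l ^ 2 ≤ d :=
      nhdsWithin_le_nhds hflowA₁
    have h2 : ∀ᶠ T in 𝓝[>] Tc, T ≠ Tc → Tendsto (fun l => (u T l)⁻¹) atTop (𝓝 (ρ T / T)) :=
      nhdsWithin_le_nhds hid
    filter_upwards [h1, h2, self_mem_nhdsWithin] with T hT hi hTgt
    have hTgt' : Tc < T := hTgt
    have hzero : ρ T / T = 0 := by rw [hTr.2 hTgt', zero_div]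
    have hlim : Tendsto (fun l => (u T l)⁻¹) atTop (𝓝 0) := hzero ▸ hi hTgt'.ne'
    -- `K⁻¹` cannot converge to a finite limit (its inverse would have a positive limit)
    rcases hT.1.exists_tendsto_or_tendsto_atTop with ⟨uinf, h0le, hulim⟩ | htop
    · exfalso
      have hpos : 0 < uinf := hT.1.inv_pos.trans_le h0le
      have h3 : Tendsto (fun l => (u T l)⁻¹) atTop (𝓝 uinf⁻¹) := hulim.inv₀ hpos.ne'
      have h4 : uinf⁻¹ = 0 := tendsto_nhds_unique h3 hlim
      exact (inv_pos.2 hpos).ne' h4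
    · exact hT.1.not_tendsto_fug_zero_of_tendsto_atTop htop
  have hid' : ∀ᶠ T in 𝓝[<] Tc, Tendsto (fun l => (u T l)⁻¹) atTop (𝓝 (ρ T / T)) := by
    have h2 : ∀ᶠ T in 𝓝[<] Tc, T ≠ Tc → Tendsto (fun l => (u T l)⁻¹) atTop (𝓝 (ρ T / T)) :=
      nhdsWithin_le_nhds hid
    filter_upwards [h2, Ioo_mem_nhdsLT hTc] with T hi hTI using hi hTI.2.ne
  exact universalJumpAt_of_phaseBoundary hTc hA₁ hA₂ hflow hord hdis.frequently hcont hid'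

/-- **The stiffness of such a system is DISCONTINUOUS at `T_c`**: under the hypotheses of
`universalJumpAt_of_isTransitionAt_of_flowFamily` the profile `ρ` jumps from `(2/π)·T_c > 0` to `0`
at `T_c` (`KosterlitzThoulessStiffnessBound.not_continuousAt_of_universalJumpAt`) — the flow-picture
counterpart of the discontinuity of the superfluid density (Nelson 2002, Fig. 2.8; for the classical
XY model a theorem of Chayes 1998). [cite: Nelson2002Defects, §2.2.3 eq. (2.72), Fig. 2.8] -/
theorem not_continuousAt_of_isTransitionAt_of_flowFamily {C A₁ A₂ Tc : ℝ} {u y : ℝ → ℝ → ℝ}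
    {ρ : ℝ → ℝ} (hTc : 0 < Tc) (hA₁ : 0 < A₁) (hA₂ : 0 ≤ A₂)
    (hflow : ∀ᶠ T in 𝓝 Tc, IsPerturbedFlowTrajectory C (u T) (y T) ∧
      ∀ ⦃l : ℝ⦄, 0 ≤ l → ∃ d : ℝ, HasDerivWithinAt (u T) d (Ici 0) l ∧
        A₁ * y T l ^ 2 ≤ d ∧ d ≤ A₂ * y T l ^ 2)
    (hcont : ∀ ⦃l : ℝ⦄, 0 ≤ l →
      ContinuousAt (fun T => u T l) Tc ∧ ContinuousAt (fun T => y T l) Tc)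
    (hTr : IsTransitionAt ρ Tc)
    (hid : ∀ᶠ T in 𝓝 Tc, T ≠ Tc → Tendsto (fun l => (u T l)⁻¹) atTop (𝓝 (ρ T / T))) :
    ¬ ContinuousAt ρ Tc :=
  not_continuousAt_of_universalJumpAt
    (universalJumpAt_of_isTransitionAt_of_flowFamily hTc hA₁ hA₂ hflow hcont hTr hid) hTr.2 hTc

end KosterlitzThouless

end Literature.MathematicalPhysics.StatisticalMechanics
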